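import Summits.BirchSwinnertonDyer.BirchSwinnertonDyer.Theorems.ClassRecordThreeEulerHalvesAtThreeEichlerShimuraTorsionCountA
import HarnessLib

/-!
# The torsion-refined Shapiro count for a general finite-index level `Γ ∋ -1` over an arbitrary field `K`, part B: ORBIT COUNTING

Helper file (route `ClassRecordThree`, crux `EulerHalvesAtThree`, print residue (SIGᶜ-lift)(ii); seat bsd-idea-10 g24, `--supports
stmt-BirchSwinnertonDyer-19109 --as helper`). Verbatim port of the tree's `…LambdaCongruenceAtTwoSdTorsionOrbitCount` (written for `X = SL(2, ℤ)/Γ₀(N)`) to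
`X = SL(2, ℤ)/Γ` for any `Γ ∋ -1` with `X` finite: the characteristic-free replacements of the two trace identities of `…EichlerShimuraLevelCountA` —
for the ELLIPTIC-REFINED kernels `kerS`, `kerST` of part A,
* `finrank_kerS_le`, `two_mul_finrank_kerS_add_card_le`: `2 dim kerS + #Fix(S) ≤ |X|` (restriction to one representative per free `S`-orbit is injective);
* `finrank_kerST_le`, `three_mul_finrank_kerST_add_card_le`: `3 dim kerST + 2 #Fix(ST) ≤ 2|X|` (`b ↦ (b(r), b(STr))_r` over free-orbit representatives).
No named facts; nothing specific to BSD; no summit statement is proved.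

## References
* G. Shimura, *Introduction to the arithmetic theory of automorphic functions* (1971), §8.2 (8.2.24) [ShimuraIATAF1971].
* J. E. Cremona, *Algorithms for modular elliptic curves* (1997), §2.2 [CremonaAlgorithms1997].
-/

noncomputable section

open scoped MatrixGroups ModularForm

open CongruenceSubgroup Matrix.SpecialLinearGroup ModularGroup

set_option linter.dupNamespace false

namespace Summit.BirchSwinnertonDyer.BirchSwinnertonDyer.Theorems.EichlerShimuraLevelK

open _root_.Module _root_.LinearMap
open Literature.NumberTheory.EllipticCurves.ModularForms
open scoped Classical

variable {K : Type*} [Field K] {Γ : Subgroup SL(2, ℤ)} [Fact ((-1 : SL(2, ℤ)) ∈ Γ)]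

omit [Field K] in
/-- `S(Sx) = x` on cosets (`S² = -1 ∈ Γ`). [folklore] -/
theorem S_smul_S_smul (x : SL(2, ℤ) ⧸ Γ) : S • S • x = x := by
  rw [← mul_smul, S_mul_S_eq_neg_one, EichlerShimuraLevel.neg_one_smul_coset']

omit [Field K] in
/-- `(ST)³x = x` on cosets (`(ST)³ = -1 ∈ Γ`). [folklore] -/
theorem ST_smul_ST_smul_ST_smul (x : SL(2, ℤ) ⧸ Γ) : (S * T) • (S * T) • (S * T) • x = x := by
  rw [← mul_smul, ← mul_smul, ParabolicCount.ST_pow_three_eq, EichlerShimuraLevel.neg_one_smul_coset']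

variable [Fintype (SL(2, ℤ) ⧸ Γ)]

/-! ### Orbit representatives and the two dimension bounds -/


/-- An injective enumeration of the cosets by natural numbers (used only to CHOOSE one representative in
each free `S`- and `ST`-orbit). [folklore] -/
def rk (x : (SL(2, ℤ) ⧸ Γ)) : ℕ := (Fintype.equivFin ((SL(2, ℤ) ⧸ Γ)) x : ℕ)

omit [Fact ((-1 : SL(2, ℤ)) ∈ Γ)] in
/-- `rk` is injective. [folklore] -/
theorem rk_injective : Function.Injective (rk (Γ := Γ)) := fun _ _ h ↦
  (Fintype.equivFin ((SL(2, ℤ) ⧸ Γ))).injective (Fin.ext h)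

variable (Γ) in
/-- One representative in each FREE `S`-orbit `{x, Sx}` (`Sx ≠ x`): the element of smaller `rk`. [folklore] -/
def repS : Finset ((SL(2, ℤ) ⧸ Γ)) :=
  Finset.univ.filter fun x ↦ S • x ≠ x ∧ rk x < rk (S • x)

variable (Γ) in
/-- One representative in each FREE `ST`-orbit `{x, STx, (ST)²x}` (`STx ≠ x`): the element of least `rk`.
[folklore] -/
def repST : Finset ((SL(2, ℤ) ⧸ Γ)) :=
  Finset.univ.filter fun x ↦
    (S * T) • x ≠ x ∧ rk x < rk ((S * T) • x) ∧ rk x < rk ((S * T) • (S * T) • x)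

omit [Fact ((-1 : SL(2, ℤ)) ∈ Γ)] in
/-- Membership in `repS`. [folklore] -/
theorem mem_repS_iff (x : (SL(2, ℤ) ⧸ Γ)) : x ∈ repS Γ ↔ S • x ≠ x ∧ rk x < rk (S • x) := by
  simp [repS]

omit [Fact ((-1 : SL(2, ℤ)) ∈ Γ)] in
/-- Membership in `repST`. [folklore] -/
theorem mem_repST_iff (x : (SL(2, ℤ) ⧸ Γ)) :
    x ∈ repST Γ ↔
      (S * T) • x ≠ x ∧ rk x < rk ((S * T) • x) ∧ rk x < rk ((S * T) • (S * T) • x) := by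
  simp [repST]

/-- Every point of a free `S`-orbit is `x` or `Sx` for a representative `x`. [folklore] -/
theorem mem_repS_or {x : (SL(2, ℤ) ⧸ Γ)} (hx : S • x ≠ x) : x ∈ repS Γ ∨ S • x ∈ repS Γ := by
  have hne : rk x ≠ rk (S • x) := fun h ↦ hx (rk_injective h).symm
  rcases lt_or_gt_of_ne hne with h | h
  · exact Or.inl ((mem_repS_iff x).mpr ⟨hx, h⟩)
  · refine Or.inr ((mem_repS_iff _).mpr ⟨?_, ?_⟩)
    · rw [S_smul_S_smul]
      exact Ne.symm hx
    · rwa [S_smul_S_smul]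

omit [Fintype (SL(2, ℤ) ⧸ Γ)] in
/-- If `STx ≠ x` then `x`, `STx`, `(ST)²x` are pairwise distinct. [folklore] -/
theorem ST_smul_ne_of_ne {x : (SL(2, ℤ) ⧸ Γ)} (hx : (S * T) • x ≠ x) :
    (S * T) • (S * T) • x ≠ x ∧ (S * T) • (S * T) • x ≠ (S * T) • x := by
  refine ⟨fun h ↦ hx ((EichlerShimuraLevel.ST_smul_iff x).mp h), fun h ↦ hx ?_⟩
  -- `U(Ux) = Ux` makes `Ux` a fixed point, hence `x = U³x = U(U(Ux)) = Ux`
  have h3 := ST_smul_ST_smul_ST_smul (Γ := Γ) x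
  rw [h, h] at h3
  exact h3

/-- Every point of a free `ST`-orbit is `x`, `STx` or `(ST)²x` for a representative `x`. [folklore] -/
theorem mem_repST_or {x : (SL(2, ℤ) ⧸ Γ)} (hx : (S * T) • x ≠ x) :
    x ∈ repST Γ ∨ (S * T) • x ∈ repST Γ ∨ (S * T) • (S * T) • x ∈ repST Γ := by
  obtain ⟨h2, h12⟩ := ST_smul_ne_of_ne hx
  have h3 := ST_smul_ST_smul_ST_smul (Γ := Γ) x
  have r01 : rk x ≠ rk ((S * T) • x) := fun h ↦ hx (rk_injective h).symm
  have r02 : rk x ≠ rk ((S * T) • (S * T) • x) := fun h ↦ h2 (rk_injective h).symm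
  have r12 : rk ((S * T) • x) ≠ rk ((S * T) • (S * T) • x) := fun h ↦ h12 (rk_injective h).symm
  by_cases h0 : rk x < rk ((S * T) • x) ∧ rk x < rk ((S * T) • (S * T) • x)
  · exact Or.inl ((mem_repST_iff x).mpr ⟨hx, h0⟩)
  by_cases h1 : rk ((S * T) • x) < rk x ∧ rk ((S * T) • x) < rk ((S * T) • (S * T) • x)
  · refine Or.inr (Or.inl ((mem_repST_iff _).mpr ⟨fun h ↦ h12 h, ?_, ?_⟩))
    · exact h1.2
    · rw [h3]
      exact h1.1
  · refine Or.inr (Or.inr ((mem_repST_iff _).mpr ⟨?_, ?_, ?_⟩))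
    · rw [h3]
      exact Ne.symm h2
    · rw [h3]
      omega
    · rw [h3]
      omega

/-- **A function in `kerS` vanishing on the representatives vanishes**: on a fixed coset by definition, at a
representative by hypothesis, and at `Sx` by `a(Sx) = -a(x)`. [folklore] -/
theorem eq_zero_of_forall_repS {a : (SL(2, ℤ) ⧸ Γ) → K} (ha : a ∈ kerS K Γ)
    (h : ∀ r ∈ repS Γ, a r = 0) : a = 0 := by
  funext x
  by_cases hx : S • x = x
  · exact ha.2 x hx
  rcases mem_repS_or hx with hr | hr
  · exact h x hr
  · have h1 := congr_fun ha.1 (S • x)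
    rw [relS_apply, S_smul_S_smul, h _ hr, zero_add] at h1
    exact h1

/-- **A function in `kerST` vanishing at `r` and `STr` for every representative `r` vanishes** (the third
point of each free orbit by `b(x) + b(STx) + b((ST)²x) = 0`). [folklore] -/
theorem eq_zero_of_forall_repST {b : (SL(2, ℤ) ⧸ Γ) → K} (hb : b ∈ kerST K Γ)
    (h0 : ∀ r ∈ repST Γ, b r = 0) (h1 : ∀ r ∈ repST Γ, b ((S * T) • r) = 0) : b = 0 := by
  funext x
  by_cases hx : (S * T) • x = x
  · exact hb.2 x hx
  have h3 := ST_smul_ST_smul_ST_smul (Γ := Γ) x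
  rcases mem_repST_or hx with hr | hr | hr
  · exact h0 x hr
  · -- `x = (ST)²r` for `r = STx`
    have h := congr_fun hb.1 ((S * T) • x)
    rw [relST_apply, h3, h0 _ hr, h1 _ hr, zero_add, zero_add] at h
    exact h
  · -- `x = ST r` for `r = (ST)²x`
    have h := h1 _ hr
    rwa [h3] at h

variable (K Γ) in
/-- **`dim kerS ≤ #(free S-orbits)`**: restriction to the representatives is injective. [folklore] -/
theorem finrank_kerS_le : finrank K (kerS K Γ) ≤ (repS Γ).card := by
  let res : kerS K Γ →ₗ[K] (repS Γ → K) :=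
    { toFun := fun a r ↦ (a : (SL(2, ℤ) ⧸ Γ) → K) r
      map_add' := fun _ _ ↦ rfl
      map_smul' := fun _ _ ↦ rfl }
  have hinj : Function.Injective res := by
    intro a b hab
    apply Subtype.ext
    have hmem : (a : (SL(2, ℤ) ⧸ Γ) → K) - b ∈ kerS K Γ := (kerS K Γ).sub_mem a.2 b.2
    have h0 := eq_zero_of_forall_repS hmem fun r hr ↦ by
      have := congr_fun hab ⟨r, hr⟩
      simp only [res, LinearMap.coe_mk, AddHom.coe_mk] at this
      simp [this]
    exact sub_eq_zero.mp h0
  have h := LinearMap.finrank_le_finrank_of_injective hinj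
  rwa [finrank_fintype_fun_eq_card, Fintype.card_coe] at h

variable (K Γ) in
/-- **`dim kerST ≤ 2 · #(free ST-orbits)`**: `b ↦ (b(r), b(STr))_r` is injective. [folklore] -/
theorem finrank_kerST_le : finrank K (kerST K Γ) ≤ 2 * (repST Γ).card := by
  let res : kerST K Γ →ₗ[K] (repST Γ → K) × (repST Γ → K) :=
    { toFun := fun b ↦ (fun r ↦ (b : (SL(2, ℤ) ⧸ Γ) → K) r, fun r ↦ (b : (SL(2, ℤ) ⧸ Γ) → K) ((S * T) • r))
      map_add' := fun _ _ ↦ rfl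
      map_smul' := fun _ _ ↦ rfl }
  have hinj : Function.Injective res := by
    intro a b hab
    apply Subtype.ext
    have hmem : (a : (SL(2, ℤ) ⧸ Γ) → K) - b ∈ kerST K Γ := (kerST K Γ).sub_mem a.2 b.2
    have hab' := Prod.mk.inj hab
    have h0 := eq_zero_of_forall_repST hmem
      (fun r hr ↦ by
        have := congr_fun hab'.1 ⟨r, hr⟩
        simp only at this
        simp [this])
      (fun r hr ↦ by
        have := congr_fun hab'.2 ⟨r, hr⟩
        simp only at this
        simp [this])
    exact sub_eq_zero.mp h0
  have h := LinearMap.finrank_le_finrank_of_injective hinj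
  rwa [finrank_prod, finrank_fintype_fun_eq_card, Fintype.card_coe, ← two_mul] at h

/-- **`2 · #(free S-orbit representatives) + ε₂ ≤ μ`**: the fixed cosets, the representatives and their
`S`-translates are pairwise disjoint. [folklore] -/
theorem two_mul_card_repS_add_card_le :
    2 * (repS Γ).card + (Finset.univ.filter fun x : (SL(2, ℤ) ⧸ Γ) ↦ S • x = x).card ≤
      Fintype.card ((SL(2, ℤ) ⧸ Γ)) := by
  set F := Finset.univ.filter fun x : (SL(2, ℤ) ⧸ Γ) ↦ S • x = x
  set R := repS Γ
  set R' := R.image fun x ↦ S • x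
  have hR' : R'.card = R.card := Finset.card_image_of_injective _ (MulAction.injective S)
  have hd1 : Disjoint R R' := by
    rw [Finset.disjoint_left]
    intro x hx hx'
    obtain ⟨y, hy, rfl⟩ := Finset.mem_image.mp hx'
    rw [mem_repS_iff, S_smul_S_smul] at hx
    rw [mem_repS_iff] at hy
    omega
  have hd2 : Disjoint F (R ∪ R') := by
    rw [Finset.disjoint_left]
    intro x hx hx'
    have hfx : S • x = x := (Finset.mem_filter.mp hx).2
    rcases Finset.mem_union.mp hx' with h | h
    · exact ((mem_repS_iff x).mp h).1 hfx
    · obtain ⟨y, hy, rfl⟩ := Finset.mem_image.mp h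
      have h1 : S • y = y := by
        have h2 := congrArg (fun z ↦ S • z) hfx
        simpa only [S_smul_S_smul] using h2
      exact ((mem_repS_iff y).mp hy).1 h1
  calc 2 * R.card + F.card = (F ∪ (R ∪ R')).card := by
        rw [Finset.card_union_of_disjoint hd2, Finset.card_union_of_disjoint hd1, hR']
        ring
    _ ≤ Fintype.card ((SL(2, ℤ) ⧸ Γ)) := Finset.card_le_univ _

/-- **`3 · #(free ST-orbit representatives) + ε₃ ≤ μ`**: the fixed cosets, the representatives `r` and their
translates `STr`, `(ST)²r` are pairwise disjoint. [folklore] -/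
theorem three_mul_card_repST_add_card_le :
    3 * (repST Γ).card + (Finset.univ.filter fun x : (SL(2, ℤ) ⧸ Γ) ↦ (S * T) • x = x).card ≤
      Fintype.card ((SL(2, ℤ) ⧸ Γ)) := by
  set F := Finset.univ.filter fun x : (SL(2, ℤ) ⧸ Γ) ↦ (S * T) • x = x
  set R := repST Γ
  set R₁ := R.image fun x ↦ (S * T) • x
  set R₂ := R.image fun x ↦ (S * T) • (S * T) • x
  have h3 := ST_smul_ST_smul_ST_smul (Γ := Γ)
  have hinj2 : Function.Injective fun x : (SL(2, ℤ) ⧸ Γ) ↦ (S * T) • (S * T) • x :=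
    (MulAction.injective (S * T)).comp (MulAction.injective (S * T))
  have hR₁ : R₁.card = R.card := Finset.card_image_of_injective _ (MulAction.injective (S * T))
  have hR₂ : R₂.card = R.card := Finset.card_image_of_injective _ hinj2
  -- two representatives in one orbit coincide: the three exclusions
  have hex1 : ∀ y ∈ R, (S * T) • y ∉ R := fun y hy hy' ↦ by
    rw [mem_repST_iff] at hy hy'
    rw [h3] at hy'
    omega
  have hex2 : ∀ y ∈ R, (S * T) • (S * T) • y ∉ R := fun y hy hy' ↦ by
    rw [mem_repST_iff] at hy hy'
    rw [h3] at hy'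
    omega
  have hd12 : Disjoint R₁ R₂ := by
    rw [Finset.disjoint_left]
    intro x hx hx'
    obtain ⟨y, hy, rfl⟩ := Finset.mem_image.mp hx
    obtain ⟨z, hz, hyz⟩ := Finset.mem_image.mp hx'
    -- `(ST)²z = STy` gives `y = ST⋅((ST)² z) … = ST z`? No: apply `ST` twice: `y = (ST)⁴ z = ST z`
    have hy' : y = (S * T) • z := by
      have := congrArg (fun w ↦ (S * T) • (S * T) • w) hyz
      simpa only [h3] using this.symm
    exact hex1 z hz (hy' ▸ hy)
  have hd0 : Disjoint R (R₁ ∪ R₂) := by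
    rw [Finset.disjoint_left]
    intro x hx hx'
    rcases Finset.mem_union.mp hx' with h | h
    · obtain ⟨y, hy, rfl⟩ := Finset.mem_image.mp h
      exact hex1 y hy hx
    · obtain ⟨y, hy, rfl⟩ := Finset.mem_image.mp h
      exact hex2 y hy hx
  have hdF : Disjoint F (R ∪ (R₁ ∪ R₂)) := by
    rw [Finset.disjoint_left]
    intro x hx hx'
    have hfx : (S * T) • x = x := (Finset.mem_filter.mp hx).2
    rcases Finset.mem_union.mp hx' with h | h
    · exact ((mem_repST_iff x).mp h).1 hfx
    rcases Finset.mem_union.mp h with h | h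
    · obtain ⟨y, hy, rfl⟩ := Finset.mem_image.mp h
      -- `ST(STy) = STy` ⇒ `y` is fixed
      have h1 : (S * T) • y = y := by
        have h2 := congrArg (fun z ↦ (S * T) • (S * T) • z) hfx
        simpa only [h3] using h2
      exact ((mem_repST_iff y).mp hy).1 h1
    · obtain ⟨y, hy, rfl⟩ := Finset.mem_image.mp h
      have h1 : (S * T) • y = y := by
        have h2 := congrArg (fun z ↦ (S * T) • z) hfx
        simpa only [h3] using h2
      exact ((mem_repST_iff y).mp hy).1 h1
  calc 3 * R.card + F.card = (F ∪ (R ∪ (R₁ ∪ R₂))).card := by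
        rw [Finset.card_union_of_disjoint hdF, Finset.card_union_of_disjoint hd0,
          Finset.card_union_of_disjoint hd12, hR₁, hR₂]
        ring
    _ ≤ Fintype.card ((SL(2, ℤ) ⧸ Γ)) := Finset.card_le_univ _

/-- **`2 dim kerS + ε₂ ≤ μ`** (the characteristic-free replacement of `2 rk(1 + S^*) = μ + ε₂`). [folklore] -/
theorem two_mul_finrank_kerS_add_card_le :
    2 * finrank K (kerS K Γ) + (Finset.univ.filter fun x : (SL(2, ℤ) ⧸ Γ) ↦ S • x = x).card ≤
      Fintype.card ((SL(2, ℤ) ⧸ Γ)) :=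
  le_trans (Nat.add_le_add_right (Nat.mul_le_mul_left 2 (finrank_kerS_le K Γ)) _)
    two_mul_card_repS_add_card_le

/-- **`3 dim kerST + 2ε₃ ≤ 2μ`** (the characteristic-free replacement of `3 rk(1 + U + U²) = μ + 2ε₃`).
[folklore] -/
theorem three_mul_finrank_kerST_add_card_le :
    3 * finrank K (kerST K Γ) + 2 * (Finset.univ.filter fun x : (SL(2, ℤ) ⧸ Γ) ↦ (S * T) • x = x).card ≤
      2 * Fintype.card ((SL(2, ℤ) ⧸ Γ)) := by
  have h1 := finrank_kerST_le K Γ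
  have h2 := three_mul_card_repST_add_card_le (Γ := Γ)
  omega

end Summit.BirchSwinnertonDyer.BirchSwinnertonDyer.Theorems.EichlerShimuraLevelK

end
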